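import Summits.FinalStateConjecture.FinalStateConjecture.Theorems.GapDecaySuffices.Negative.PosCoreFalseOfLabelSwapWitness
import Summits.FinalStateConjecture.FinalStateConjecture.Theorems.GapDecaySuffices.Negative.RelabelDecomposition

/-!
# `PosCore` is false as soon as ONE HONEST input has a label permutation without neck certificate
# (`GapDecaySuffices`, crux stmt-FinalStateConjecture-18060 — negative side, sharpening of p137241)

Refuter seat `refuter-cdisprove-stmt-FinalStateConjecture-18060-0`, 2026-08-17.  Sorry-free, standard axioms.

With the relabelling machinery of `RelabelCovariance.lean` / `RelabelDecomposition.lean` (p137850, p138268) the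
hypothesis of the landed negative lemma `posCore_false_of_labelSwapWitness` (p137241) is pushed back from
"an input satisfying the antecedent with no `NeckCertificate`" to "an HONEST input (antecedent verbatim, with the
`‖L‖²`-slack form of `Hf`(3)) together with relabelling data `Δ` (a model Poincaré map permuting its label lines,
orthochronous on the labels) such that the RELABELLED input `d.relabel Δ` has no `NeckCertificate`":
`HonestPermutableWitness → LabelSwapWitness` (`labelSwapWitness_of_honestPermutableWitness`, by
`antecedent_relabel`), hence `HonestPermutableWitness → ¬ PosCore`.  What is left to paper is exactly the
no-bridge contradiction of the docstring of `LabelSwapWitness` (K5/K6/K10 for the swapped binary), a statement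
about ONE honest two-hole development.
-/

noncomputable section

open scoped Manifold ContDiff Topology ENNReal
open Filter Set Topology Literature.Geometry.Lorentzian

namespace Summit.FinalStateConjecture.FinalStateConjecture.Theorems.GapDecaySuffices.Negative

set_option linter.dupNamespace false

open Relabel

/-- The `NeckCertificate` bundle K1–K12 of the v5 skeleton (body VERBATIM the `let NeckCertificate` of p131681,
β-reduced), as a predicate of `(𝓢, O, d, R₀)`. [folklore] -/
def NeckCertificateOf (𝓢 : Spacetime.{0} 4) (O : Set 𝓢.carrier) (d : FinalStateDecomposition 𝓢 O 4)
    (R₀ : ℝ) : Prop :=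
      let B := d.background; let t := fun i ↦ (B i).time; let r := fun i ↦ (B i).radius
      let Λ := fun i ↦ ((d.motion i).1 : E4 ≃L[ℝ] E4); let Φ := d.flatChart; let Ψ := d.chart
      let ρ := d.excision
      ∃ (R₁ τ₁ : ℝ) (ρa Rc : Fin d.N → ℝ → ℝ) (Ψa : ∀ i, (B i).domain → 𝓢.carrier),
        R₀ ≤ R₁ ∧ d.τ₀ ≤ τ₁ ∧
        (∀ i, Monotone (ρa i) ∧ Continuous (ρa i) ∧ Tendsto (fun s ↦ ρa i s / s) atTop (𝓝 0) ∧
          Tendsto (ρa i) atTop atTop ∧ ∀ s, R₁ + 1 ≤ ρa i s ∧ (τ₁ ≤ s → ρ i s + 1 ≤ ρa i s)) ∧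
        (∀ i, Monotone (Rc i) ∧ Continuous (Rc i) ∧ Tendsto (fun s ↦ Rc i s / s) atTop (𝓝 0) ∧
          Tendsto (Rc i) atTop atTop ∧ ∀ s, R₁ + 4 ≤ Rc i s) ∧
        (∀ j (y : E4), τ₁ ≤ y 0 → r j y ≤ 9 * ρa j (y 0) → r j y + 3 ≤ Rc j (t j y)) ∧
        (∀ i, let U : Set (B i).domain := {x | τ₁ < t i x.1 ∧ r i x.1 < Rc i (t i x.1) + 2}
          ContMDiffOn 𝓘(ℝ, E4) (𝓡 4) ∞ (Ψa i) U ∧ IsOpenEmbedding (U.restrict (Ψa i)) ∧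
            Ψa i '' U ⊆ d.charted) ∧
        (∀ i (x : (B i).domain), r i x.1 ≤ R₁ + 1 → Ψa i x = Ψ i x) ∧
        (∀ i (y : E4) (hy : y ∈ (B i).domain), τ₁ ≤ y 0 → 4 * ρa i (y 0) ≤ r i y →
          r i y ≤ Rc i (t i y) + 2 → ∃ hy' : y ∈ d.flatDomain, Ψa i ⟨y, hy⟩ = Φ ⟨y, hy'⟩) ∧
        (∀ i, Tendsto (fun τ ↦ 𝓢.truncDeviationCk (B i) (Ψa i) 2 (Rc i τ) τ) atTop (𝓝 0)) ∧
        (∀ i, supCkENorm (Subtype.val '' {x : (B i).domain | τ₁ ≤ t i x.1 ∧ R₁ ≤ r i x.1 ∧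
            r i x.1 ≤ Rc i (t i x.1) + 2}) 0 (𝓢.deviationExtend (B i) (Ψa i)) ≤
          ENNReal.ofReal (1 / (10 * ‖(Λ i : E4 →L[ℝ] E4)‖ ^ 2))) ∧
        (∀ i (x : (B i).domain), τ₁ ≤ t i x.1 → R₁ ≤ r i x.1 → r i x.1 ≤ Rc i (t i x.1) + 2 →
          𝓢.timeOrientation.IsFutureDirected
            (mfderiv 𝓘(ℝ, E4) (𝓡 4) (Ψa i) x ((Λ i) (E4.basisVector 0)))) ∧
        (∀ i j, i ≠ j → Disjoint (Ψa i '' {x | τ₁ < t i x.1 ∧ r i x.1 < Rc i (t i x.1) + 2})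
          (Ψa j '' {x | τ₁ < t j x.1 ∧ r j x.1 < Rc j (t j x.1) + 2})) ∧
        (∀ i (τ' : ℝ) (ϱ : ℝ → ℝ), Continuous ϱ → τ₁ < τ' → (∀ s, ϱ s < Rc i s + 2) →
          closure (Ψa i '' {x | τ' ≤ t i x.1 ∧ r i x.1 ≤ ϱ (t i x.1)}) ∩ O ⊆
            Ψa i '' {x | τ' ≤ t i x.1 ∧ r i x.1 ≤ ϱ (t i x.1)}) ∧
        (∀ (T : ℝ) (Th : Fin d.N → ℝ), τ₁ < T → (∀ j, τ₁ < Th j) →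
          (∀ j (y : E4), T < y 0 → r j y ≤ Rc j (t j y) + 2 → Th j < t j y) →
          O \ (Φ '' {y | T < y.1 0 ∧ ∀ j, 5 * ρa j (y.1 0) < r j y.1} ∪
              ⋃ j, Ψa j '' {x | Th j < t j x.1 ∧ r j x.1 < Rc j (t j x.1) + 2}) ⊆
            𝓢.metric.causalPast 𝓢.timeOrientation
              (Φ '' {y | y.1 0 = T ∧ ∀ j, 5 * ρa j (y.1 0) < r j y.1} ∪
                ⋃ j, Ψa j '' {x | t j x.1 = Th j ∧ r j x.1 < Rc j (t j x.1) + 2}))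

/-- **`H_perm`: an honest input one of whose label permutations admits no neck certificate.**  There are an
admissible datum, an MGHD `𝒟`, an honest `C⁴` input `d` of `O = exteriorOf 𝒟 d.charted` (`HonestCoreOf`,
`HonestFarOf` — the route's `Hc`, `Hf` — pairwise distinct label velocities, `0 < d.N`), relabelling data `Δ`
(`RelabelData`: `P x = L x + p`, permutation `π`, slack `C`) keeping the labels orthochronous and met by the
input's far deviation with the slack `‖L‖²` (eventually free when the far deviation tends to `0` on the Voronoi
cells), such that the relabelled input `d.relabel Δ` admits NO `NeckCertificate`.  Intended inhabitant: any
honest non-comoving binary with `Δ` the swap of its two label lines (docstring of `LabelSwapWitness`: K5 pins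
`Ψₐ₁` to hole `A`, K6 pins it to `B`'s flat collar, K10 fails by an IVT crossing) — a statement about ONE honest
two-hole development, not about an exotic input.
[topic: Summits/FinalStateConjecture/FinalStateConjecture — multi-black-hole chart kinematics, label gauge] -/
def HonestPermutableWitness : Prop :=
  ∃ (X : Type) (_ : TopologicalSpace X) (_ : ChartedSpace E3 X) (_ : IsManifold (𝓡 3) ∞ X)
    (_ : ConnectedSpace X) (D : InitialDataSet (𝓡 3) X) (_ : D ∈ admissibleVacuumData X)
    (𝒟 : VacuumCauchyDevelopment D) (_ : 𝒟.IsMaximal)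
    (O : Set 𝒟.carrier) (d : FinalStateDecomposition 𝒟.toSpacetime O 4) (R₀ : ℝ) (Δ : RelabelData d),
    O = exteriorOf 𝒟.toCauchyDevelopment d.charted ∧ HonestCoreOf d R₀ ∧ HonestFarOf d R₀ ∧
    DistinctLabels d ∧ 0 < d.N ∧
    (∀ i, 0 < (((Δ.L⁻¹ * (d.motion i).1 : lorentzGroup) : E4 ≃L[ℝ] E4) (E4.basisVector 0)) 0) ∧
    (∀ i, ∃ T : ℝ, supCkENorm (Subtype.val '' {x : (d.background i).domain |
        T ≤ (d.background i).time x.1 ∧ R₀ ≤ (d.background i).radius x.1 ∧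
          ∀ j, j ≠ i → (d.background i).radius x.1 ≤ (d.background j).radius x.1}) 0
        (𝒟.toSpacetime.deviationExtend (d.background i) (d.chart i)) ≤
      ENNReal.ofReal (1 / (10 * (‖((Δ.L : E4 ≃L[ℝ] E4) : E4 →L[ℝ] E4)‖ ^ 2 *
        ‖(((Δ.L⁻¹ * (d.motion i).1 : lorentzGroup) : E4 ≃L[ℝ] E4) : E4 →L[ℝ] E4)‖ ^ 2)))) ∧
    ¬ NeckCertificateOf 𝒟.toSpacetime O (relabel d Δ) R₀

/-- **`H_perm → H_swap`**: the relabelled input of an `H_perm`-witness is an `H_swap`-witness — it satisfies the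
antecedent of `PosCore` verbatim (`antecedent_relabel`) and has no `NeckCertificate`. [folklore] -/
theorem labelSwapWitness_of_honestPermutableWitness (hH : HonestPermutableWitness) : LabelSwapWitness := by
  obtain ⟨X, i₁, i₂, i₃, i₄, D, hD, 𝒟, h𝒟, O, d, R₀, Δ, hO, hc, hf, hdv, hN, horth, hslack, hno⟩ := hH
  obtain ⟨hO', hc', hf', hdv'⟩ := antecedent_relabel 𝒟 d Δ R₀ hO hc hf hdv horth hslack
  exact ⟨X, i₁, i₂, i₃, i₄, D, hD, 𝒟, h𝒟, O, relabel d Δ, R₀, hO', hc', hf', hdv', hN, hno⟩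

/-- **NEGATIVE LEMMA MODULO `H_perm`**: `HonestPermutableWitness → ¬ PosCore` — the registered stub behind the
advertised proof of `GapDecaySuffices` is false as soon as one honest input has a label permutation without neck
certificate (the swap of any honest non-comoving binary, on paper). [folklore] -/
theorem posCore_false_of_honestPermutableWitness (hH : HonestPermutableWitness) : ¬ PosCore :=
  posCore_false_of_labelSwapWitness (labelSwapWitness_of_honestPermutableWitness hH)

end Summit.FinalStateConjecture.FinalStateConjecture.Theorems.GapDecaySuffices.Negative

end
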